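import Summits.BirchSwinnertonDyer.BirchSwinnertonDyer.Theorems.CongruentShaFreeCutTwoAdicControlOfSelmerFinite
import Summits.BirchSwinnertonDyer.BirchSwinnertonDyer.Theorems.CongruentShaFreeCutTwoAdicControlOfPoitouTate
import Literature.NumberTheory.GaloisCohomology.PoitouTateSumTotallyComplex
import Literature.NumberTheory.EllipticCurves.Castella2018.AnticyclotomicSelmerDualModuleFinite
import Literature.NumberTheory.EllipticCurves.IwasawaEulerCharRankZeroProofs
import Literature.NumberTheory.EllipticCurves.HeegnerPointsImaginaryQuadraticProofs
import Literature.NumberTheory.EllipticCurves.Rank1Residual.Predicates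
import HarnessLib

/-!
# AC-CONTROL₂(β) = LINK A₂ of the node «anticyclotomic two-link road at 2 on (β)» is a KERNEL THEOREM,
# UNCONDITIONALLY: anticyclotomic control in the `∃ m` currency — `rank E(K) = 1 ∧ #Ш(E/K)[p^∞] < ∞ ⟹
# X_ac(E[p^∞])` is `Λ`-torsion with `𝓕(0) ≠ 0` — for EVERY elliptic `E/ℚ`, EVERY prime `p` (so `p = 2`), every
# imaginary quadratic `K` with `p` split and every anticyclotomic `ℤ_p`-line (crux `BDPSelmerLowerDivisibilityAtTwo`,
# stmt-BirchSwinnertonDyer-24728; route `TwoAdicConverse`, rung S3)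

Helper file `--supports stmt-BirchSwinnertonDyer-24728` (cell `bsd-2adic`, seat `bsd-2adic-tower-1` GEN 52; key
«AC-CONTROL₂(β)» = director-bsd (626)(b), pen SUMMON 20260830T172650Z). THEOREMS ONLY (no definition, no named
fact, no instance, no `sorry`).

THE TARGET. Seat 1's node `Cruxes/BDPSelmerLowerDivisibilityAtTwo/Lines/anticyclotomic_two_link_two.lean`
(`…Cruxes.BDPSelmerLowerDivisibilityAtTwo.AnticyclotomicTwoLinkTwo`) re-keys the rank-`0` conjunct 19218 on the
residually reducible branch (β) to two ONE-VARIABLE anticyclotomic statements at `2`, LINK A₂ `AcControlAtTwoBeta`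
(algebraic: at rank-one data over `K`, `∃ m, AcSelmer.XAc.HasCharValuationAt (E_K) 2 κ v̄ ∅ γ m`, i.e. Castella's
`𝔛 = X_{v̄}^{∅}(E[2^∞])` is `Λ = ℤ₂⟦T⟧`-torsion and a characteristic generator has `𝓕(0) ≠ 0`) and LINK B♭₂
(analytic), with every seam PROVED there. LINK A₂ was tagged «UNDECIDED, leaf ATTACKABLE (algebra)»; the printed
shape (JSW 2017 Thm. 3.3.1, CGLS 2022 Thm. 5.1.1, Castella 2018 Thm. 2.3) is typed in the tree for odd `p` only.

THE OBSERVATION OF THIS FILE. The whole chain behind LINK A₂ is ALREADY KERNEL MATHEMATICS in the tree, proved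
by cell `bsd-cn100` (routes `CongruentShaFreeCut` / `MordellShaFreeCut`, whose Links A have the SAME shape at the
additive primes `2` and `3`) for an ARBITRARY elliptic, globally minimal `W/ℚ` and an ARBITRARY prime `p` —
nothing in it uses the curve `E_n`, the reduction type at `p`, `E[p]` (ir)reducibility, or `p` odd:

* (P4, bottom finiteness) `CongruentShaFreeCutTwoAdicSelmerFinite.finite_selmerAcBase_of_rankOne` /
  `…TwoAdicControlOfPoitouTate.finite_selmerAcBase_of_rankOne_of_poitouTate`: `K` imaginary quadratic, `p` split,
  `rank E(K) = 1`, `#Ш(E/K)[p^∞] < ∞`, `𝔭 ∋ p` ⟹ Castella's Selmer group OVER `K` (strict at `𝔭`, relaxed at `𝔭̄`,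
  trivial off `p`; `X11b.AcSelmer.selmerAcBase (W_K) p 𝔭 ∅`) is FINITE — JSW Prop. 3.2.1's level bound (local
  index of the rank-one Kummer line in `E(ℚ_p)`, Poitou–Tate twice) uniform in the level, CONDITIONAL there on
  the named fact `poitouTate_sum_localTatePairing_eq_zero K` (Tate's local Euler characteristic being the tree
  theorem `EP.forall_localEulerPoincareCharacteristic_adicCompletion`);
* (Poitou–Tate) that named fact is a THEOREM for totally complex `K`:
  `Literature.NumberTheory.GaloisCohomology.poitouTate_sum_localTatePairing_eq_zero_of_isTotallyComplex`
  (Tate, Cassels–Fröhlich VII §11; the (F1) campaign of `bsd-cn100`), and an imaginary quadratic field is totally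
  complex (`IsImaginaryQuadratic.isTotallyComplex`);
* (P3, control proper + P1, `Λ`-algebra) `CongruentShaFreeCutTwoAdicControlOfSelmerFinite.
  hasCharValuationAt_of_finite_selmerAcBase`: `Sel_𝔭(K, E[p^∞])` finite ⟹ `Sel_𝔭(K_∞, E[p^∞])^γ` finite (the
  X11b counting snake lemma with the STRICT place among the counted local kernels — no hypothesis on `E(K_𝔭)[p]`,
  Greenberg's Lemmas 3.2/3.3 at every place, away descent) ⟹ `𝔛` finitely generated (Castella's
  `XAc.module_finite`, dual Nakayama), `Λ`-torsion with principal characteristic ideal and `𝓕(0) ≠ 0`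
  (Greenberg's Lemma 4.2 criterion), stated ON THE LITERATURE OBJECT `Castella2018.AcSelmer.XAc` through the
  `Iff.rfl` bridge `X11b.AcSelmer.hasCharValuationAt_iff_literature`.

So this file is a COMPOSITION (every theorem a few lines), recorded in the O2 frame:

* §1 (any prime `p`, any elliptic globally minimal `W/ℚ`): `finite_selmerAcBase_of_rankOne` (P4 with Poitou–Tate
  DISCHARGED), `finite_endInvariants_selmerAc_of_rankOne` (P3: `Sel_{v̄}(K_∞, E[p^∞])^γ` finite at rank-one
  data), **`hasCharValuationAt_of_rankOne`** (`∃ m, HasCharValuationAt (W.baseChange K) p κ v̄ ∅ γ m` at rank-one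
  data: the anticyclotomic control theorem in the `∃ m` currency, every finite error term — anomalous factor,
  `E(K)[p]`, Tamagawa numbers — swallowed by the currency, exactly as the node's typing note anticipated);
* §2 (`p = 2`): **`acControlAtTwoBeta`** — the body of the node's `AcControlAtTwoBeta` CHARACTER FOR CHARACTER
  (a Theorems file may not import a `Cruxes/` file; the by-name closure
  `theorem AcControlAtTwoBeta_holds : AnticyclotomicTwoLinkTwo.AcControlAtTwoBeta := fun W _ _ => acControlAtTwoBeta W`
  is a one-liner for the node file), in which the hypotheses `¬ HasCM`, `GoodOrd W 2`,
  `¬ HasIrreducibleModPGaloisRep 2`, the Heegner hypothesis for `N_E`, `ι`, `v`, `v̄ ≠ v` are IDLE (kept for the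
  verbatim match); and `acControlAt_of_heegnerHypothesis` — the same at every prime `p`.

CONSEQUENCE FOR THE NODE (recorded, not re-proved here): with LINK A₂ a theorem, the node's PROVED seams
`rankZeroTwoConverseBeta_of_links` / `goodOrdinaryRankZeroTwoConverse_of_alpha_of_links` make the rank-`0`
conjunct 19218 on (β) depend on PRINT ∧ LINK B♭₂ ALONE (the one-variable anticyclotomic lower inclusion at the
trivial character at `2` ∘ the `2`-adic BDP value) — the research content is now entirely on the analytic side.
HONEST FRAMING: LINK B♭₂, O2, 19556, 19218 stay OPEN; BSD is proved for no curve by any of this; typed ≠ proved —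
but LINK A₂ is now PROVED, not typed.

References: [JetchevSkinnerWan2017] Prop. 3.2.1, Thm. 3.3.1 (§3.3); [CastellaGrossiLeeSkinner2022] Thm. 5.1.1;
[Castella2018] Def. 2.2, Thm. 2.3; [GreenbergLNM1716] §3 Lemmas 3.2–3.3, p. 90, §4 Lemma 4.2; [MilneADT2006] I
Thm. 4.10(b), Thm. 2.8; [CasselsFrohlichANT1967] Ch. VII §11.
-/

-- D-0017: single-problem summit, the namespace repeats the problem name by design.
set_option linter.dupNamespace false
set_option autoImplicit false

noncomputable section

open scoped Classical

namespace Summit.BirchSwinnertonDyer.BirchSwinnertonDyer.Theorems.TwoAdicBDPAcControl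

open WeierstrassCurve NumberField IsDedekindDomain Field Literature.NumberTheory.EllipticCurves
  Literature.NumberTheory.EllipticCurves.Castella2018 Literature.NumberTheory.EllipticCurves.Rank1Residual
  Literature.NumberTheory.GaloisCohomology Summit.BirchSwinnertonDyer.Rank1Residual
  Summit.BirchSwinnertonDyer.BirchSwinnertonDyer.Theorems.CongruentShaFreeCutTwoAdicControlOfSelmerFinite
  Summit.BirchSwinnertonDyer.BirchSwinnertonDyer.Theorems.CongruentShaFreeCutTwoAdicControlOfPoitouTate

/-! ## §1 Any prime `p`: anticyclotomic control in the `∃ m` currency at rank-one data, unconditionally -/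

section AnyPrime

variable (W : WeierstrassCurve ℚ) [W.IsElliptic] [W.IsGloballyMinimal] (p : ℕ) [Fact p.Prime]
  {K : Type} [Field K] [NumberField K]

/-- **P4 — bottom finiteness, Poitou–Tate DISCHARGED.** For an elliptic, globally minimal `W/ℚ`, ANY prime `p`, an
imaginary quadratic `K` in which `p` splits, `rank E(K) = 1`, `#Ш(E/K)[p^∞] < ∞` and a prime `v̄ ∋ p` of `K`:
Castella's Selmer group over `K` — `Sel_{v̄}(K, E[p^∞])`, strict at `v̄`, relaxed at `v`, trivial off `p`
(`X11b.AcSelmer.selmerAcBase (W_K) p v̄ ∅`) — is FINITE. `bsd-cn100`'s `finite_selmerAcBase_of_rankOne_of_poitouTate`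
(JSW Prop. 3.2.1 level bound + limit) with its Poitou–Tate hypothesis supplied by Tate's theorem for the totally
complex field `K` (`poitouTate_sum_localTatePairing_eq_zero_of_isTotallyComplex`).
[cite: JetchevSkinnerWan2017, Prop. 3.2.1 (proof, arXiv:1512.06894 pp. 10–11)] [cite: CasselsFrohlichANT1967, Ch. VII §11] -/
theorem finite_selmerAcBase_of_rankOne (hK : IsImaginaryQuadratic K) (hsplit : X11b.SplitsIn K p)
    (hrank : (W.baseChange K).mordellWeilRank = 1)
    (hsha : Finite (AddCommGroup.primaryComponent (W.baseChange K).sha p))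
    (vbar : HeightOneSpectrum (𝓞 K)) (hvbar : ((p : ℕ) : 𝓞 K) ∈ vbar.asIdeal) :
    Finite (X11b.AcSelmer.selmerAcBase (W.baseChange K) p vbar ∅) := by
  haveI : IsTotallyComplex K := hK.isTotallyComplex
  exact finite_selmerAcBase_of_rankOne_of_poitouTate W p K
    (poitouTate_sum_localTatePairing_eq_zero_of_isTotallyComplex K) hK hsplit hrank hsha vbar hvbar

/-- **P3 — control proper at rank-one data, unconditionally**: under the hypotheses of
`finite_selmerAcBase_of_rankOne` and for an anticyclotomic `ℤ_p`-extension `κ` of `K` with topological generator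
`γ`, the `Γ`-invariants `Sel_{v̄}(K_∞, E[p^∞])^γ = ker(conj_γ − 1)` of Castella's Selmer group over the tower are
FINITE (`bsd-cn100`'s `finite_endInvariants_of_finite_selmerAcBase`: counting snake lemma, the strict place among
the counted local kernels, Greenberg's Lemmas 3.2/3.3, away descent — no hypothesis at `p` on the curve).
[cite: GreenbergLNM1716, §3 Lemma 3.2, Lemma 3.3 (p. 87), p. 90] [cite: JetchevSkinnerWan2017, §3.3 (proof of Thm. 3.3.1)] -/
theorem finite_endInvariants_selmerAc_of_rankOne (hK : IsImaginaryQuadratic K) (hsplit : X11b.SplitsIn K p)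
    (κ : ZpExtension K p) (hκ : κ.IsAnticyclotomic) (γ : absoluteGaloisGroup K) [Fact (κ.IsTopGenerator γ)]
    (hrank : (W.baseChange K).mordellWeilRank = 1)
    (hsha : Finite (AddCommGroup.primaryComponent (W.baseChange K).sha p))
    (vbar : HeightOneSpectrum (𝓞 K)) (hvbar : ((p : ℕ) : 𝓞 K) ∈ vbar.asIdeal) :
    Finite (IwasawaDual.endInvariants (X11b.AcSelmer.conjSelmerAc (W.baseChange K) p κ vbar ∅ γ - 1)) := by
  haveI := finite_selmerAcBase_of_rankOne W p hK hsplit hrank hsha vbar hvbar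
  exact finite_endInvariants_of_finite_selmerAcBase W p hK hsplit κ hκ γ vbar hvbar

/-- **THE ANTICYCLOTOMIC CONTROL THEOREM IN THE `∃ m` CURRENCY, ANY PRIME, UNCONDITIONAL.** For an elliptic,
globally minimal `W/ℚ`, ANY prime `p`, an imaginary quadratic `K` in which `p` splits, an anticyclotomic
`ℤ_p`-extension `κ` of `K` with topological generator `γ`, a prime `v̄ ∋ p` of `K`, `rank E(K) = 1` and
`#Ш(E/K)[p^∞] < ∞`: Castella's dual Selmer module `𝔛 = X_{v̄}^{∅}(E[p^∞]) = AcSelmer.XAc (W_K) p κ v̄ ∅ γ` is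
`Λ`-torsion and a generator `𝓕` of `char_Λ 𝔛` has `𝓕(0) ≠ 0` — `∃ m, HasCharValuationAt (W.baseChange K) p κ v̄ ∅ γ m`
ON THE LITERATURE OBJECT. Composition of `finite_selmerAcBase_of_rankOne` (P4, Poitou–Tate discharged) and
`bsd-cn100`'s `hasCharValuationAt_of_finite_selmerAcBase` (P3 control + Castella's finite generation + Greenberg's
Lemma 4.2). The printed theorems of this shape (JSW Thm. 3.3.1, CGLS Thm. 5.1.1, Castella Thm. 2.3) assume `p`
odd and more; the `∃ m` currency needs none of it. [cite: JetchevSkinnerWan2017, Thm. 3.3.1 (shape) and Prop. 3.2.1]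
[cite: GreenbergLNM1716, §4 Lemma 4.2] [cite: Castella2018, Def. 2.2 and Thm. 2.3 (arXiv:1704.06608 p. 5) (shape)] -/
theorem hasCharValuationAt_of_rankOne (hK : IsImaginaryQuadratic K) (hsplit : X11b.SplitsIn K p)
    (κ : ZpExtension K p) (hκ : κ.IsAnticyclotomic) (γ : absoluteGaloisGroup K) [Fact (κ.IsTopGenerator γ)]
    (vbar : HeightOneSpectrum (𝓞 K)) (hvbar : ((p : ℕ) : 𝓞 K) ∈ vbar.asIdeal)
    (hrank : (W.baseChange K).mordellWeilRank = 1)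
    (hsha : Finite (AddCommGroup.primaryComponent (W.baseChange K).sha p)) :
    ∃ m : ℕ, Castella2018.AcSelmer.XAc.HasCharValuationAt (W.baseChange K) p κ vbar ∅ γ m := by
  haveI := finite_selmerAcBase_of_rankOne W p hK hsplit hrank hsha vbar hvbar
  exact hasCharValuationAt_of_finite_selmerAcBase W p hK hsplit κ hκ γ vbar hvbar

/-- The same with the splitting of `p` supplied by **the Heegner hypothesis for `p`** (`SatisfiesHeegnerHypothesis p K`
says every prime factor of `p`, i.e. `p`, splits in `K`) — the binder shape of the node's links.
[cite: JetchevSkinnerWan2017, Thm. 3.3.1 (shape) and Prop. 3.2.1] [cite: GreenbergLNM1716, §4 Lemma 4.2] -/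
theorem hasCharValuationAt_of_rankOne_of_heegnerHypothesis (hK : IsImaginaryQuadratic K)
    (hHp : SatisfiesHeegnerHypothesis p K) (κ : ZpExtension K p) (hκ : κ.IsAnticyclotomic)
    (γ : absoluteGaloisGroup K) [Fact (κ.IsTopGenerator γ)]
    (vbar : HeightOneSpectrum (𝓞 K)) (hvbar : ((p : ℕ) : 𝓞 K) ∈ vbar.asIdeal)
    (hrank : (W.baseChange K).mordellWeilRank = 1)
    (hsha : Finite (AddCommGroup.primaryComponent (W.baseChange K).sha p)) :
    ∃ m : ℕ, Castella2018.AcSelmer.XAc.HasCharValuationAt (W.baseChange K) p κ vbar ∅ γ m :=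
  hasCharValuationAt_of_rankOne W p hK (hHp p Fact.out (dvd_refl p)) κ hκ γ vbar hvbar hrank hsha

end AnyPrime

/-! ## §2 `p = 2`: LINK A₂ `AcControlAtTwoBeta` of the node, character for character -/

/-- **AC-CONTROL₂(β) = LINK A₂ — the body of `AnticyclotomicTwoLinkTwo.AcControlAtTwoBeta` VERBATIM, PROVED.** For
every non-CM, globally minimal `E/ℚ`, good ordinary at `2`, with `E[2]` residually reducible; every imaginary
quadratic `K` with the Heegner hypothesis for `N_E` and for `2`; `ι : K ↪ ℚ₂` inducing `v`, `v̄ ∋ 2`, `v̄ ≠ v`; every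
anticyclotomic `ℤ₂`-extension `κ` with topological generator `γ`:
`rank E(K) = 1 ∧ #Ш(E/K)[2^∞] < ∞ ⟹ ∃ m, AcSelmer.XAc.HasCharValuationAt (E_K) 2 κ v̄ ∅ γ m`.
Instance `p = 2` of `hasCharValuationAt_of_rankOne`; the hypotheses `¬ HasCM`, `GoodOrd`, `¬ HasIrreducibleModPGaloisRep 2`,
the Heegner hypothesis for `N_E`, `ι`, `v`, `v̄ ≠ v` are IDLE (kept for the character-for-character match with the
node decl; the by-name closure `AnticyclotomicTwoLinkTwo.AcControlAtTwoBeta` is `fun W _ _ => acControlAtTwoBeta W`,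
checked in the seat's scratch file, a Theorems file being unable to import `Cruxes/`).
[cite: JetchevSkinnerWan2017, Thm. 3.3.1 (shape) and Prop. 3.2.1] [cite: CastellaGrossiLeeSkinner2022, Thm. 5.1.1 (shape)]
[cite: GreenbergLNM1716, §3 Lemma 3.3, p. 90; §4 Lemma 4.2] [cite: CasselsFrohlichANT1967, Ch. VII §11] -/
theorem acControlAtTwoBeta (W : WeierstrassCurve ℚ) [W.IsElliptic] [W.IsGloballyMinimal] :
    ¬ W.HasCM → GoodOrd W 2 → ¬ W.HasIrreducibleModPGaloisRep 2 →
    ∀ (K : Type) [Field K] [NumberField K], IsImaginaryQuadratic K →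
      SatisfiesHeegnerHypothesis (W.conductorNorm ℤ) K → SatisfiesHeegnerHypothesis 2 K →
    ∀ (ι : K →+* ℚ_[2]) (v vbar : HeightOneSpectrum (𝓞 K)),
      (∀ x : 𝓞 K, x ∈ v.asIdeal ↔ ‖ι (x : K)‖ < 1) → ((2 : ℕ) : 𝓞 K) ∈ vbar.asIdeal → vbar ≠ v →
    ∀ (κ : ZpExtension K 2), κ.IsAnticyclotomic →
    ∀ (γ : absoluteGaloisGroup K) [Fact (κ.IsTopGenerator γ)],
      (W.baseChange K).mordellWeilRank = 1 →
      Finite (AddCommGroup.primaryComponent (W.baseChange K).sha 2) →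
      ∃ m : ℕ, AcSelmer.XAc.HasCharValuationAt (W.baseChange K) 2 κ vbar ∅ γ m :=
  fun _ _ _ _ _ _ hK _ hH2 _ _ vbar _ hvbar _ κ hκ γ _ hrank hsha ↦
    hasCharValuationAt_of_rankOne_of_heegnerHypothesis W 2 hK hH2 κ hκ γ vbar hvbar hrank hsha

/-- **LINK A₂ as a closed `∀ W` statement** (the node's `AcControlAtTwoBeta` with its leading binders), PROVED.
[cite: JetchevSkinnerWan2017, Thm. 3.3.1 (shape) and Prop. 3.2.1] [cite: GreenbergLNM1716, §4 Lemma 4.2] -/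
theorem acControlAtTwoBeta_forall :
    ∀ (W : WeierstrassCurve ℚ) [W.IsElliptic] [W.IsGloballyMinimal], ¬ W.HasCM → GoodOrd W 2 →
      ¬ W.HasIrreducibleModPGaloisRep 2 →
    ∀ (K : Type) [Field K] [NumberField K], IsImaginaryQuadratic K →
      SatisfiesHeegnerHypothesis (W.conductorNorm ℤ) K → SatisfiesHeegnerHypothesis 2 K →
    ∀ (ι : K →+* ℚ_[2]) (v vbar : HeightOneSpectrum (𝓞 K)),
      (∀ x : 𝓞 K, x ∈ v.asIdeal ↔ ‖ι (x : K)‖ < 1) → ((2 : ℕ) : 𝓞 K) ∈ vbar.asIdeal → vbar ≠ v →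
    ∀ (κ : ZpExtension K 2), κ.IsAnticyclotomic →
    ∀ (γ : absoluteGaloisGroup K) [Fact (κ.IsTopGenerator γ)],
      (W.baseChange K).mordellWeilRank = 1 →
      Finite (AddCommGroup.primaryComponent (W.baseChange K).sha 2) →
      ∃ m : ℕ, AcSelmer.XAc.HasCharValuationAt (W.baseChange K) 2 κ vbar ∅ γ m :=
  fun W _ _ ↦ acControlAtTwoBeta W

/-- **The same at every prime `p`** (the node's binder shape with `2 ↦ p`; the idle hypotheses dropped): for an
elliptic, globally minimal `W/ℚ`, `K` imaginary quadratic with the Heegner hypothesis for `p`, `v̄ ∋ p`, `κ`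
anticyclotomic with topological generator `γ`: `rank E(K) = 1 ∧ #Ш(E/K)[p^∞] < ∞ ⟹ ∃ m, HasCharValuationAt (E_K) p κ v̄ ∅ γ m`.
[cite: JetchevSkinnerWan2017, Thm. 3.3.1 (shape) and Prop. 3.2.1] [cite: GreenbergLNM1716, §4 Lemma 4.2] -/
theorem acControlAt_of_heegnerHypothesis (p : ℕ) [Fact p.Prime] :
    ∀ (W : WeierstrassCurve ℚ) [W.IsElliptic] [W.IsGloballyMinimal]
      (K : Type) [Field K] [NumberField K], IsImaginaryQuadratic K → SatisfiesHeegnerHypothesis p K →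
    ∀ (vbar : HeightOneSpectrum (𝓞 K)), ((p : ℕ) : 𝓞 K) ∈ vbar.asIdeal →
    ∀ (κ : ZpExtension K p), κ.IsAnticyclotomic →
    ∀ (γ : absoluteGaloisGroup K) [Fact (κ.IsTopGenerator γ)],
      (W.baseChange K).mordellWeilRank = 1 →
      Finite (AddCommGroup.primaryComponent (W.baseChange K).sha p) →
      ∃ m : ℕ, AcSelmer.XAc.HasCharValuationAt (W.baseChange K) p κ vbar ∅ γ m :=
  fun W _ _ _ _ _ hK hHp vbar hvbar κ hκ γ _ hrank hsha ↦
    hasCharValuationAt_of_rankOne_of_heegnerHypothesis W p hK hHp κ hκ γ vbar hvbar hrank hsha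

/-! ## §3 (appended) The conjuncts BY NAME on the Literature object, any prime: `Sel_{v̄}(K_∞)^γ` finite,
`𝔛/T𝔛` finite (the SUMMON's typed hypothesis `AcCoinvariantsFiniteOfRankOneAtTwoBeta` — BOTH conjuncts are theorems),
`𝔛` finitely generated and `Λ`-torsion, `char 𝔛 = (𝓕)` with `𝓕(0) ≠ 0` -/

section Conjuncts

variable (W : WeierstrassCurve ℚ) [W.IsElliptic] [W.IsGloballyMinimal] (p : ℕ) [Fact p.Prime]
  {K : Type} [Field K] [NumberField K]

/-- **`Sel_{v̄}(K_∞, E[p^∞])^γ` is finite at rank-one data, ON THE LITERATURE OBJECT** `Castella2018.AcSelmer.selmerAc`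
(the X11b twin of `finite_endInvariants_selmerAc_of_rankOne` is the same term: Castella's construction was re-homed
to Literature with identical bodies, so the transfer is definitional). [cite: GreenbergLNM1716, §3 Lemma 3.2, Lemma 3.3, p. 90]
[cite: Castella2018, Def. 2.2 (arXiv:1704.06608 p. 5)] -/
theorem finite_endInvariants_conjSelmerAc_of_rankOne (hK : IsImaginaryQuadratic K) (hsplit : X11b.SplitsIn K p)
    (κ : ZpExtension K p) (hκ : κ.IsAnticyclotomic) (γ : absoluteGaloisGroup K) [Fact (κ.IsTopGenerator γ)]
    (vbar : HeightOneSpectrum (𝓞 K)) (hvbar : ((p : ℕ) : 𝓞 K) ∈ vbar.asIdeal)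
    (hrank : (W.baseChange K).mordellWeilRank = 1)
    (hsha : Finite (AddCommGroup.primaryComponent (W.baseChange K).sha p)) :
    Finite (IwasawaDual.endInvariants
      (Castella2018.AcSelmer.conjSelmerAc (W.baseChange K) p κ vbar ∅ γ - 1)) :=
  finite_endInvariants_selmerAc_of_rankOne W p hK hsplit κ hκ γ hrank hsha vbar hvbar

/-- **`𝔛/T𝔛` is finite at rank-one data** (`𝔛 = AcSelmer.XAc (W_K) p κ v̄ ∅ γ`, `𝔛/T𝔛 = IwasawaAlgebra.coinvariants p 𝔛`):
Pontryagin duality `𝔛/T𝔛 ≅ Hom(Sel^γ, ℚ/ℤ)` for the dual pair `XAc.isDualPair` (`IsDualPair.finite_coinvariants_iff`)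
and `finite_endInvariants_conjSelmerAc_of_rankOne`. With Castella's `XAc.module_finite` this discharges BOTH
conjuncts of the pen's typed hypothesis «`𝔛` finitely generated ∧ `𝔛/T𝔛` finite at rank-one (β) data».
[cite: GreenbergLNM1716, §1 pp. 60–62 (`X/TX` dual to `Sel^Γ`)] [cite: Castella2018, Def. 2.2 (arXiv:1704.06608 p. 5)] -/
theorem finite_coinvariants_xAc_of_rankOne (hK : IsImaginaryQuadratic K) (hsplit : X11b.SplitsIn K p)
    (κ : ZpExtension K p) (hκ : κ.IsAnticyclotomic) (γ : absoluteGaloisGroup K) [Fact (κ.IsTopGenerator γ)]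
    (vbar : HeightOneSpectrum (𝓞 K)) (hvbar : ((p : ℕ) : 𝓞 K) ∈ vbar.asIdeal)
    (hrank : (W.baseChange K).mordellWeilRank = 1)
    (hsha : Finite (AddCommGroup.primaryComponent (W.baseChange K).sha p)) :
    Finite (IwasawaAlgebra.coinvariants p (Castella2018.AcSelmer.XAc (W.baseChange K) p κ vbar ∅ γ)) :=
  (Castella2018.AcSelmer.XAc.isDualPair (W.baseChange K) p κ vbar ∅ γ).finite_coinvariants_iff.mpr
    (finite_endInvariants_conjSelmerAc_of_rankOne W p hK hsplit κ hκ γ vbar hvbar hrank hsha)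

omit [W.IsGloballyMinimal] in
/-- **`𝔛` is a finitely generated `Λ`-module** (Castella's sentence, the tree theorem `XAc.module_finite_empty`, recorded
in this frame for the pair «f.g. ∧ `𝔛/T𝔛` finite»; no rank hypothesis). [cite: Castella2018, Def. 2.2 (arXiv:1704.06608 p. 5)]
[cite: GreenbergLNM1716, §1 p. 60 (after Conj. 1.3)] -/
theorem moduleFinite_xAc (κ : ZpExtension K p) (γ : absoluteGaloisGroup K) [Fact (κ.IsTopGenerator γ)]
    (vbar : HeightOneSpectrum (𝓞 K)) :
    Module.Finite (IwasawaAlgebra p) (Castella2018.AcSelmer.XAc (W.baseChange K) p κ vbar ∅ γ) := by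
  haveI : (W.baseChange K).IsElliptic := by rw [baseChange]; infer_instance
  exact Castella2018.AcSelmer.XAc.module_finite_empty (W.baseChange K) p κ vbar γ

/-- **`𝔛` is `Λ`-torsion at rank-one data** (first conjunct of `HasCharValuationAt`, by name).
[cite: JetchevSkinnerWan2017, Thm. 3.3.1 (shape)] [cite: GreenbergLNM1716, §4 Lemma 4.2] -/
theorem isTorsion_xAc_of_rankOne (hK : IsImaginaryQuadratic K) (hsplit : X11b.SplitsIn K p)
    (κ : ZpExtension K p) (hκ : κ.IsAnticyclotomic) (γ : absoluteGaloisGroup K) [Fact (κ.IsTopGenerator γ)]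
    (vbar : HeightOneSpectrum (𝓞 K)) (hvbar : ((p : ℕ) : 𝓞 K) ∈ vbar.asIdeal)
    (hrank : (W.baseChange K).mordellWeilRank = 1)
    (hsha : Finite (AddCommGroup.primaryComponent (W.baseChange K).sha p)) :
    Module.IsTorsion (IwasawaAlgebra p) (Castella2018.AcSelmer.XAc (W.baseChange K) p κ vbar ∅ γ) := by
  obtain ⟨m, hm⟩ := hasCharValuationAt_of_rankOne W p hK hsplit κ hκ γ vbar hvbar hrank hsha
  exact hm.1

/-- **`char_Λ 𝔛 = (𝓕)` with `𝓕(0) ≠ 0` at rank-one data** (second conjunct of `HasCharValuationAt`, by name; the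
valuation `ord_p 𝓕(0)` is the `m` of `hasCharValuationAt_of_rankOne` and is generator-independent,
`HasCharValuationAt.unique`). [cite: JetchevSkinnerWan2017, Thm. 3.3.1 (shape)] [cite: GreenbergLNM1716, §4 Lemma 4.2] -/
theorem exists_charIdeal_xAc_eq_span_constantCoeff_ne_zero_of_rankOne (hK : IsImaginaryQuadratic K)
    (hsplit : X11b.SplitsIn K p) (κ : ZpExtension K p) (hκ : κ.IsAnticyclotomic) (γ : absoluteGaloisGroup K)
    [Fact (κ.IsTopGenerator γ)] (vbar : HeightOneSpectrum (𝓞 K)) (hvbar : ((p : ℕ) : 𝓞 K) ∈ vbar.asIdeal)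
    (hrank : (W.baseChange K).mordellWeilRank = 1)
    (hsha : Finite (AddCommGroup.primaryComponent (W.baseChange K).sha p)) :
    ∃ F : IwasawaAlgebra p,
      Castella2018.AcSelmer.XAc.charIdeal (W.baseChange K) p κ vbar ∅ γ = Ideal.span {F} ∧
        PowerSeries.constantCoeff F ≠ 0 := by
  obtain ⟨m, -, F, hF, hF0, -⟩ := hasCharValuationAt_of_rankOne W p hK hsplit κ hκ γ vbar hvbar hrank hsha
  exact ⟨F, hF, hF0⟩

end Conjuncts

end Summit.BirchSwinnertonDyer.BirchSwinnertonDyer.Theorems.TwoAdicBDPAcControl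

end
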